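import Literature.NumberTheory.Rogawski1990.ArchSingularMembersOfFrame               -- ★ p843796 (W4d): `exists_archSingularMembers_withData`, `exists_archSingularMembers`
import Literature.NumberTheory.QuadraticForms.LandherrHermitianMatricesDiagonalize    -- ★ Landherr: `Landherr.exists_congr_diagonal`
import HarnessLib

/-!
# THE ARCHIMEDEAN HALF OF S1′ FROM THE FRAME'S REGULAR DATA ALONE: the rational diagonal frames discharged («(W4e)»; Landherr 1936; Rogawski 1990 §14.2)

Topic `NumberTheory/Rogawski1990`; namespace `Literature.NumberTheory.Rogawski1990`.  THEOREMS ONLY (no `def`, no instance, no notation, no axiom, no named fact, no `sorry`).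
Cell `pub/hodgecm-mathlib`, ENGINE T1 (crux H413 = `stmt-HodgeConjecture-24833`); (ST-∞) witness road, brick (W4e) (F0P3a-p07 (g9); LEAD F0P3a-plan (g10)).  Count-neutral; HONEST
LABEL: HC_CM is proved only modulo the printed citations until rung 0 closes.

* **`exists_rational_diagonal_frame`** — a `c`-hermitian non-degenerate `H ∈ M₃(L)` has a RATIONAL diagonal frame in `formCongr` shape: `∃ α P, c(P)ᵀ · diag α · P = H`, `αᵢ ≠ 0`,
  `c αᵢ = αᵢ` (★ `Landherr.exists_congr_diagonal` gives `c(G)ᵀ H G = diag α`; invert the congruence with ★ `formCongr_inv_formCongr`, `P := G⁻¹`).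
* **`exists_archSingularMembers_withData_of_regularData`**, **`exists_archSingularMembers_of_regularData`** — ★ p843796's two heads with the frame binders
  `α′ P hP hα′ hhermα β Q hQ hβ hhermβ` DISCHARGED (`H′`: the lemma above with `hd′`; `Φ₃`: ★ `formCongr_quasiSplitFrame_diagonal`, ★ `quasiSplitWeights_ne_zero`,
  ★ `cmConjRingHom_quasiSplitWeights`): the five archimedean conjuncts of S1′ from the S1′ frame's REGULAR archimedean Weil data and NOTHING ELSE.

## References
* [Landherr1936HermitianForms] W. Landherr, *Äquivalenz Hermitescher Formen über einem beliebigen algebraischen Zahlkörper*, Abh. Math. Sem. Hamburg 11 (1936), §1.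
* [Rogawski1990] J. D. Rogawski, *Automorphic Representations of Unitary Groups in Three Variables*, Ann. of Math. Stud. 123 (1990), §4.3 (4.3.1) p. 43; Prop. 10.1.2 (b)
  p. 146; §14.2 (14.2.1) p. 232; §14.5 Lemma 14.5.2 (b) pp. 238–239.
* [Kottwitz1988] R. E. Kottwitz, *Tamagawa numbers*, Ann. of Math. 127 (1988), Prop. 2.
-/

set_option autoImplicit false

noncomputable section

open MeasureTheory Measure Filter Topology NumberField NumberField.InfinitePlace NumberField.mixedEmbedding Equiv Function Set
open Literature.MeasureTheory.Group Literature.NumberTheory.Automorphic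
open Literature.NumberTheory.Automorphic.UnitaryGroup hiding hermForm
open Literature.AlgebraicGeometry.ShimuraVarieties (unitaryGroup hermForm)
open Literature.LinearAlgebra.Matrix
open scoped Matrix MatrixGroups Matrix.Norms.Operator ContDiff NNReal ENNReal

namespace Literature.NumberTheory.Rogawski1990

section Frame

variable (L : Type) [Field L] [NumberField L] [IsCMField L]

/-- **A RATIONAL DIAGONAL FRAME IN `formCongr` SHAPE (Landherr).**  For `H ∈ M₃(L)` `c`-hermitian with `det H ≠ 0`: `∃ α P, c(P)ᵀ · diag α · P = H` with `αᵢ ≠ 0`, `c αᵢ = αᵢ`.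
[cite: Landherr1936HermitianForms, §1] [cite: Rogawski1990, §14.2 (14.2.1) p. 232] -/
theorem exists_rational_diagonal_frame (H : Matrix (Fin 3) (Fin 3) L) (hherm : (H.map (cmConjRingHom L))ᵀ = H) (hdet : H.det ≠ 0) :
    ∃ (α : Fin 3 → L) (P : GL (Fin 3) L), formCongr (cmConjRingHom L) P (Matrix.diagonal α) = H ∧ (∀ i, α i ≠ 0) ∧
      (∀ i, (IsCMField.complexConj L (α i) : L) = α i) := by
  classical
  have hc : (⇑(cmConjRingHom L) : L → L) = IsCMField.complexConj L := funext (cmConjRingHom_apply L)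
  have hH : Literature.NumberTheory.QuadraticForms.Landherr.conjTranspose L H = H := by
    unfold Literature.NumberTheory.QuadraticForms.Landherr.conjTranspose
    rw [Matrix.transpose_map, ← hc]; exact hherm
  obtain ⟨G, hG, α, hα, hα0, e⟩ := Literature.NumberTheory.QuadraticForms.Landherr.exists_congr_diagonal L H hH hdet
  have hGval : ((Matrix.GeneralLinearGroup.mkOfDetNeZero G hG.ne_zero : GL (Fin 3) L) : Matrix (Fin 3) (Fin 3) L) = G :=
    Matrix.GeneralLinearGroup.val_mkOfDetNeZero G hG.ne_zero
  have hcongr : formCongr (cmConjRingHom L) (Matrix.GeneralLinearGroup.mkOfDetNeZero G hG.ne_zero) H = Matrix.diagonal α := by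
    rw [← e]
    unfold Literature.NumberTheory.QuadraticForms.Landherr.conjTranspose
    rw [formCongr, hGval, Matrix.transpose_map, hc]
  refine ⟨α, (Matrix.GeneralLinearGroup.mkOfDetNeZero G hG.ne_zero)⁻¹, ?_, hα0, hα⟩
  rw [← hcongr, formCongr_inv_formCongr]

end Frame

variable (L : Type) [Field L] [NumberField L] [IsCMField L] (H' : Matrix (Fin 3) (Fin 3) L)
  [iAH : MeasurableSpace (arch (↥(maximalRealSubfield L)) L (IsCMField.complexConj L) 3 H')] [iAHb : BorelSpace (arch (↥(maximalRealSubfield L)) L (IsCMField.complexConj L) 3 H')]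
  [iAG : MeasurableSpace (arch (↥(maximalRealSubfield L)) L (IsCMField.complexConj L) 3 (Matrix.of fun i j : Fin 3 => if i.val + j.val + 1 = 3 then (1 : L) else 0))]
  [iAGb : BorelSpace (arch (↥(maximalRealSubfield L)) L (IsCMField.complexConj L) 3 (Matrix.of fun i j : Fin 3 => if i.val + j.val + 1 = 3 then (1 : L) else 0))]
  [iQH : ∀ γ' : arch (↥(maximalRealSubfield L)) L (IsCMField.complexConj L) 3 H', MeasurableSpace (arch (↥(maximalRealSubfield L)) L (IsCMField.complexConj L) 3 H' ⧸ Subgroup.centralizer ({γ'} : Set _))]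
  [iQHb : ∀ γ' : arch (↥(maximalRealSubfield L)) L (IsCMField.complexConj L) 3 H', BorelSpace (arch (↥(maximalRealSubfield L)) L (IsCMField.complexConj L) 3 H' ⧸ Subgroup.centralizer ({γ'} : Set _))]
  [iQG : ∀ γ' : arch (↥(maximalRealSubfield L)) L (IsCMField.complexConj L) 3 (Matrix.of fun i j : Fin 3 => if i.val + j.val + 1 = 3 then (1 : L) else 0),
    MeasurableSpace (arch (↥(maximalRealSubfield L)) L (IsCMField.complexConj L) 3 (Matrix.of fun i j : Fin 3 => if i.val + j.val + 1 = 3 then (1 : L) else 0) ⧸ Subgroup.centralizer ({γ'} : Set _))]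
  [iQGb : ∀ γ' : arch (↥(maximalRealSubfield L)) L (IsCMField.complexConj L) 3 (Matrix.of fun i j : Fin 3 => if i.val + j.val + 1 = 3 then (1 : L) else 0),
    BorelSpace (arch (↥(maximalRealSubfield L)) L (IsCMField.complexConj L) 3 (Matrix.of fun i j : Fin 3 => if i.val + j.val + 1 = 3 then (1 : L) else 0) ⧸ Subgroup.centralizer ({γ'} : Set _))]

set_option maxHeartbeats 400000 in
/-- **(W4e) ★ `exists_archSingularMembers_withData` FROM THE REGULAR DATA ALONE** (frames discharged: `H′` by ★ `exists_rational_diagonal_frame`, `Φ₃` by ★ `formCongr_quasiSplitFrame_diagonal`).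
[cite: Rogawski1990, §4.3 (4.3.1) p. 43; Prop. 10.1.2 (b) p. 146; §14.2 (14.2.1) p. 232; §14.5 Lemma 14.5.2 (b) pp. 238–239] [cite: Kottwitz1988, Prop. 2] [cite: Landherr1936HermitianForms, §1] -/
theorem exists_archSingularMembers_withData_of_regularData
    (hherm : (H'.map (cmConjRingHom L))ᵀ = H') (hanis : ∀ x : Fin 3 → L, hermForm (cmConjRingHom L) H' x x = 0 → x = 0)
    -- the REGULAR archimedean data of the frame in Weil form: (W′)(W)(C)(C′G)
    (ν' : Measure (arch (↥(maximalRealSubfield L)) L (IsCMField.complexConj L) 3 H')) (ν : Measure (arch (↥(maximalRealSubfield L)) L (IsCMField.complexConj L) 3 (Matrix.of fun i j : Fin 3 => if i.val + j.val + 1 = 3 then (1 : L) else 0)))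
    [ν'.IsHaarMeasure] [ν'.IsMulRightInvariant] [ν.IsHaarMeasure] [ν.IsMulRightInvariant]
    (t' : ∀ γ' : arch (↥(maximalRealSubfield L)) L (IsCMField.complexConj L) 3 H', Measure (Subgroup.centralizer ({γ'} : Set (arch (↥(maximalRealSubfield L)) L (IsCMField.complexConj L) 3 H'))))
    (t : ∀ γ : arch (↥(maximalRealSubfield L)) L (IsCMField.complexConj L) 3 (Matrix.of fun i j : Fin 3 => if i.val + j.val + 1 = 3 then (1 : L) else 0), Measure (Subgroup.centralizer ({γ} : Set (arch (↥(maximalRealSubfield L)) L (IsCMField.complexConj L) 3 (Matrix.of fun i j : Fin 3 => if i.val + j.val + 1 = 3 then (1 : L) else 0)))))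
    (hd' : H'.det ≠ 0) (hd₃ : (Matrix.of fun i j : Fin 3 => if i.val + j.val + 1 = 3 then (1 : L) else 0).det ≠ 0)
    (hC : ∀ (γ₁ γ₂ : arch (↥(maximalRealSubfield L)) L (IsCMField.complexConj L) 3 (Matrix.of fun i j : Fin 3 => if i.val + j.val + 1 = 3 then (1 : L) else 0)) (h₁ : IsRegularElt (γ₁.val : GL (Fin 3) (mixedEmbedding.mixedSpace L)))
      (hc : Corresponds (conjMixed (↥(maximalRealSubfield L)) L (IsCMField.complexConj L)) (archFormOf L 3 (Matrix.of fun i j : Fin 3 => if i.val + j.val + 1 = 3 then (1 : L) else 0)) (archFormOf L 3 (Matrix.of fun i j : Fin 3 => if i.val + j.val + 1 = 3 then (1 : L) else 0)) γ₁ γ₂),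
      Measure.map ⇑(archStableCentralizerEquiv L hd₃ hd₃ hc h₁) (t γ₁) = t γ₂)
    (hC'G : ∀ (γ' : arch (↥(maximalRealSubfield L)) L (IsCMField.complexConj L) 3 H') (γ : arch (↥(maximalRealSubfield L)) L (IsCMField.complexConj L) 3 (Matrix.of fun i j : Fin 3 => if i.val + j.val + 1 = 3 then (1 : L) else 0)) (h' : IsRegularElt (γ'.val : GL (Fin 3) (mixedEmbedding.mixedSpace L)))
      (hc : Corresponds (conjMixed (↥(maximalRealSubfield L)) L (IsCMField.complexConj L)) (archFormOf L 3 H') (archFormOf L 3 (Matrix.of fun i j : Fin 3 => if i.val + j.val + 1 = 3 then (1 : L) else 0)) γ' γ),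
      Measure.map ⇑(archStableCentralizerEquiv L hd' hd₃ hc h') (t' γ') = t γ)
    (m' : OrbitalMeasureFamily (arch (↥(maximalRealSubfield L)) L (IsCMField.complexConj L) 3 H')) (m : OrbitalMeasureFamily (arch (↥(maximalRealSubfield L)) L (IsCMField.complexConj L) 3 (Matrix.of fun i j : Fin 3 => if i.val + j.val + 1 = 3 then (1 : L) else 0)))
    (hW' : m'.IsQuotientOf (fun γ => IsRegularElt (γ.val : GL (Fin 3) (mixedEmbedding.mixedSpace L))) ν' t')
    (hW : m.IsQuotientOf (fun γ => IsRegularElt (γ.val : GL (Fin 3) (mixedEmbedding.mixedSpace L))) ν t) :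
    ∃ (mGis : OrbitalMeasureFamily (arch (↥(maximalRealSubfield L)) L (IsCMField.complexConj L) 3 H')) (mqis : OrbitalMeasureFamily (arch (↥(maximalRealSubfield L)) L (IsCMField.complexConj L) 3 (Matrix.of fun i j : Fin 3 => if i.val + j.val + 1 = 3 then (1 : L) else 0)))
      (TsG : ∀ γ : arch (↥(maximalRealSubfield L)) L (IsCMField.complexConj L) 3 H', Measure ↥(Subgroup.centralizer ({γ} : Set (arch (↥(maximalRealSubfield L)) L (IsCMField.complexConj L) 3 H'))))
      (Tsq : ∀ γ : arch (↥(maximalRealSubfield L)) L (IsCMField.complexConj L) 3 (Matrix.of fun i j : Fin 3 => if i.val + j.val + 1 = 3 then (1 : L) else 0), Measure ↥(Subgroup.centralizer ({γ} : Set (arch (↥(maximalRealSubfield L)) L (IsCMField.complexConj L) 3 (Matrix.of fun i j : Fin 3 => if i.val + j.val + 1 = 3 then (1 : L) else 0))))),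
      -- (W′-s)(W-s): Weil form w.r.t. the frame's OWN `ν′`, `ν`, torus data EXPORTED (so that (J-val-K)'s `hK` can be stated about THIS datum)
      mGis.IsQuotientOf (fun x : arch (↥(maximalRealSubfield L)) L (IsCMField.complexConj L) 3 H' => ∃ γ₀ : (cmDatum L 3 H').Rational, ¬ IsRegularElt (γ₀.val : GL (Fin 3) L) ∧
          Corresponds (conjMixed (↥(maximalRealSubfield L)) L (IsCMField.complexConj L)) (archFormOf L 3 H') (archFormOf L 3 H') (cmRationalToArch L 3 H' γ₀) x) ν' TsG ∧
      mqis.IsQuotientOf (fun x : arch (↥(maximalRealSubfield L)) L (IsCMField.complexConj L) 3 (Matrix.of fun i j : Fin 3 => if i.val + j.val + 1 = 3 then (1 : L) else 0) => ∃ γ₀ : (cmDatum L 3 H').Rational, ¬ IsRegularElt (γ₀.val : GL (Fin 3) L) ∧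
          Corresponds (conjMixed (↥(maximalRealSubfield L)) L (IsCMField.complexConj L)) (archFormOf L 3 H') (archFormOf L 3 (Matrix.of fun i j : Fin 3 => if i.val + j.val + 1 = 3 then (1 : L) else 0)) (cmRationalToArch L 3 H' γ₀) x) ν Tsq ∧
      -- (INV′)(INV): every member is invariant under conjugation
      (∀ q : ConjClasses (arch (↥(maximalRealSubfield L)) L (IsCMField.complexConj L) 3 H'),
        SMulInvariantMeasure (arch (↥(maximalRealSubfield L)) L (IsCMField.complexConj L) 3 H') (arch (↥(maximalRealSubfield L)) L (IsCMField.complexConj L) 3 H' ⧸ Subgroup.centralizer ({(Quotient.out q : arch (↥(maximalRealSubfield L)) L (IsCMField.complexConj L) 3 H')} : Set _)) (mGis q)) ∧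
      (∀ q : ConjClasses (arch (↥(maximalRealSubfield L)) L (IsCMField.complexConj L) 3 (Matrix.of fun i j : Fin 3 => if i.val + j.val + 1 = 3 then (1 : L) else 0)),
        SMulInvariantMeasure (arch (↥(maximalRealSubfield L)) L (IsCMField.complexConj L) 3 (Matrix.of fun i j : Fin 3 => if i.val + j.val + 1 = 3 then (1 : L) else 0))
          (arch (↥(maximalRealSubfield L)) L (IsCMField.complexConj L) 3 (Matrix.of fun i j : Fin 3 => if i.val + j.val + 1 = 3 then (1 : L) else 0) ⧸ Subgroup.centralizer ({(Quotient.out q : arch (↥(maximalRealSubfield L)) L (IsCMField.complexConj L) 3 (Matrix.of fun i j : Fin 3 => if i.val + j.val + 1 = 3 then (1 : L) else 0))} : Set _)) (mqis q)) ∧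
      -- (C1), archimedean half
      (∀ c : ConjClasses (cmDatum L 3 H').Rational,
        (∃ ζ : L, (((Quotient.out c).val : GL (Fin 3) L) : Matrix (Fin 3) (Fin 3) L) = ζ • (1 : Matrix (Fin 3) (Fin 3) L)) →
        mGis.atPoint (archPart (↥(maximalRealSubfield L)) L (IsCMField.complexConj L) 3 H' ((cmDatum L 3 H').toAdelic (Quotient.out c))) Set.univ = 1) ∧
      -- (C1-q)
      (∀ c : ConjClasses (cmDatum L 3 (Matrix.of fun i j : Fin 3 => if i.val + j.val + 1 = 3 then (1 : L) else 0)).Rational,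
        (∃ ζ : L, (((Quotient.out c).val : GL (Fin 3) L) : Matrix (Fin 3) (Fin 3) L) = ζ • (1 : Matrix (Fin 3) (Fin 3) L)) →
        mqis.atPoint (archPart (↥(maximalRealSubfield L)) L (IsCMField.complexConj L) 3 (Matrix.of fun i j : Fin 3 => if i.val + j.val + 1 = 3 then (1 : L) else 0) ((cmDatum L 3 (Matrix.of fun i j : Fin 3 => if i.val + j.val + 1 = 3 then (1 : L) else 0)).toAdelic (Quotient.out c))) Set.univ = 1) ∧
      -- (ST-∞-s)
      (∀ (a' : arch (↥(maximalRealSubfield L)) L (IsCMField.complexConj L) 3 H' → ℂ) (a : arch (↥(maximalRealSubfield L)) L (IsCMField.complexConj L) 3 (Matrix.of fun i j : Fin 3 => if i.val + j.val + 1 = 3 then (1 : L) else 0) → ℂ),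
        ArchSmooth L 3 H' a' → ArchSmooth L 3 (Matrix.of fun i j : Fin 3 => if i.val + j.val + 1 = 3 then (1 : L) else 0) a → IsArchInnerTransfer L H' m' m a' a →
        ∀ (γ₀ : (cmDatum L 3 H').Rational) (γ : (cmDatum L 3 (Matrix.of fun i j : Fin 3 => if i.val + j.val + 1 = 3 then (1 : L) else 0)).Rational) (e₁ e₂ : L),
          Corresponds (cmConjRingHom L) H' (Matrix.of fun i j : Fin 3 => if i.val + j.val + 1 = 3 then (1 : L) else 0) (γ₀ : unitaryGroup (cmConjRingHom L) H') (γ : unitaryGroup (cmConjRingHom L) (Matrix.of fun i j : Fin 3 => if i.val + j.val + 1 = 3 then (1 : L) else 0)) →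
          e₁ ≠ e₂ →
          ((((γ₀ : unitaryGroup (cmConjRingHom L) H').val : GL (Fin 3) L) : Matrix (Fin 3) (Fin 3) L) - e₁ • (1 : Matrix (Fin 3) (Fin 3) L)) *
            ((((γ₀ : unitaryGroup (cmConjRingHom L) H').val : GL (Fin 3) L) : Matrix (Fin 3) (Fin 3) L) - e₂ • (1 : Matrix (Fin 3) (Fin 3) L)) = 0 →
          (¬ ∃ ζ : L, (((γ₀ : unitaryGroup (cmConjRingHom L) H').val : GL (Fin 3) L) : Matrix (Fin 3) (Fin 3) L) = ζ • (1 : Matrix (Fin 3) (Fin 3) L)) →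
          archStableOrbitalIntegral L 3 H' mGis (fun x => kottwitzSignArchWeight L 3 H' (ConjClasses.mk x) * a' x) (cmRationalToArch L 3 H' γ₀) =
            archStableOrbitalIntegral L 3 (Matrix.of fun i j : Fin 3 => if i.val + j.val + 1 = 3 then (1 : L) else 0) mqis
              (fun x => kottwitzSignArchWeight L 3 (Matrix.of fun i j : Fin 3 => if i.val + j.val + 1 = 3 then (1 : L) else 0) (ConjClasses.mk x) * a x) (cmRationalToArch L 3 (Matrix.of fun i j : Fin 3 => if i.val + j.val + 1 = 3 then (1 : L) else 0) γ)) := by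
  obtain ⟨α', P, hP, hα', hhermα⟩ := exists_rational_diagonal_frame L H' hherm hd'
  exact exists_archSingularMembers_withData L H' hherm hanis α' P hP hα' hhermα ![(2 : L)⁻¹, 1, -(2 : L)⁻¹]
    (Matrix.GeneralLinearGroup.mkOfDetNeZero !![(1 : L), 0, 1; 0, 1, 0; 1, 0, -1] (det_quasiSplitFrame_ne_zero L)) (formCongr_quasiSplitFrame_diagonal L)
    (quasiSplitWeights_ne_zero L) (fun i => cmConjRingHom_quasiSplitWeights L i) ν' ν t' t hd' hd₃ hC hC'G m' m hW' hW

set_option maxHeartbeats 400000 in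
/-- **(W4e) ★ `exists_archSingularMembers` (LETTER SHAPE) FROM THE REGULAR DATA ALONE**: the five archimedean conjuncts of ★ `TamagawaSingularMembersExist` ((Q-∞), (Q-q∞),
(C1)-arch, (C1-q), (ST-∞-s)) TOKEN FOR TOKEN, from the S1′ frame's regular archimedean Weil data and nothing else.
[cite: Rogawski1990, §4.3 (4.3.1) p. 43; Prop. 10.1.2 (b) p. 146; §14.5 Lemma 14.5.2 (b) pp. 238–239] [cite: Kottwitz1988, Prop. 2] [cite: Landherr1936HermitianForms, §1] -/
theorem exists_archSingularMembers_of_regularData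
    (hherm : (H'.map (cmConjRingHom L))ᵀ = H') (hanis : ∀ x : Fin 3 → L, hermForm (cmConjRingHom L) H' x x = 0 → x = 0)
    -- the REGULAR archimedean data of the frame in Weil form: (W′)(W)(C)(C′G)
    (ν' : Measure (arch (↥(maximalRealSubfield L)) L (IsCMField.complexConj L) 3 H')) (ν : Measure (arch (↥(maximalRealSubfield L)) L (IsCMField.complexConj L) 3 (Matrix.of fun i j : Fin 3 => if i.val + j.val + 1 = 3 then (1 : L) else 0)))
    [ν'.IsHaarMeasure] [ν'.IsMulRightInvariant] [ν.IsHaarMeasure] [ν.IsMulRightInvariant]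
    (t' : ∀ γ' : arch (↥(maximalRealSubfield L)) L (IsCMField.complexConj L) 3 H', Measure (Subgroup.centralizer ({γ'} : Set (arch (↥(maximalRealSubfield L)) L (IsCMField.complexConj L) 3 H'))))
    (t : ∀ γ : arch (↥(maximalRealSubfield L)) L (IsCMField.complexConj L) 3 (Matrix.of fun i j : Fin 3 => if i.val + j.val + 1 = 3 then (1 : L) else 0), Measure (Subgroup.centralizer ({γ} : Set (arch (↥(maximalRealSubfield L)) L (IsCMField.complexConj L) 3 (Matrix.of fun i j : Fin 3 => if i.val + j.val + 1 = 3 then (1 : L) else 0)))))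
    (hd' : H'.det ≠ 0) (hd₃ : (Matrix.of fun i j : Fin 3 => if i.val + j.val + 1 = 3 then (1 : L) else 0).det ≠ 0)
    (hC : ∀ (γ₁ γ₂ : arch (↥(maximalRealSubfield L)) L (IsCMField.complexConj L) 3 (Matrix.of fun i j : Fin 3 => if i.val + j.val + 1 = 3 then (1 : L) else 0)) (h₁ : IsRegularElt (γ₁.val : GL (Fin 3) (mixedEmbedding.mixedSpace L)))
      (hc : Corresponds (conjMixed (↥(maximalRealSubfield L)) L (IsCMField.complexConj L)) (archFormOf L 3 (Matrix.of fun i j : Fin 3 => if i.val + j.val + 1 = 3 then (1 : L) else 0)) (archFormOf L 3 (Matrix.of fun i j : Fin 3 => if i.val + j.val + 1 = 3 then (1 : L) else 0)) γ₁ γ₂),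
      Measure.map ⇑(archStableCentralizerEquiv L hd₃ hd₃ hc h₁) (t γ₁) = t γ₂)
    (hC'G : ∀ (γ' : arch (↥(maximalRealSubfield L)) L (IsCMField.complexConj L) 3 H') (γ : arch (↥(maximalRealSubfield L)) L (IsCMField.complexConj L) 3 (Matrix.of fun i j : Fin 3 => if i.val + j.val + 1 = 3 then (1 : L) else 0)) (h' : IsRegularElt (γ'.val : GL (Fin 3) (mixedEmbedding.mixedSpace L)))
      (hc : Corresponds (conjMixed (↥(maximalRealSubfield L)) L (IsCMField.complexConj L)) (archFormOf L 3 H') (archFormOf L 3 (Matrix.of fun i j : Fin 3 => if i.val + j.val + 1 = 3 then (1 : L) else 0)) γ' γ),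
      Measure.map ⇑(archStableCentralizerEquiv L hd' hd₃ hc h') (t' γ') = t γ)
    (m' : OrbitalMeasureFamily (arch (↥(maximalRealSubfield L)) L (IsCMField.complexConj L) 3 H')) (m : OrbitalMeasureFamily (arch (↥(maximalRealSubfield L)) L (IsCMField.complexConj L) 3 (Matrix.of fun i j : Fin 3 => if i.val + j.val + 1 = 3 then (1 : L) else 0)))
    (hW' : m'.IsQuotientOf (fun γ => IsRegularElt (γ.val : GL (Fin 3) (mixedEmbedding.mixedSpace L))) ν' t')
    (hW : m.IsQuotientOf (fun γ => IsRegularElt (γ.val : GL (Fin 3) (mixedEmbedding.mixedSpace L))) ν t) :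
    ∃ (mGis : OrbitalMeasureFamily (arch (↥(maximalRealSubfield L)) L (IsCMField.complexConj L) 3 H')) (mqis : OrbitalMeasureFamily (arch (↥(maximalRealSubfield L)) L (IsCMField.complexConj L) 3 (Matrix.of fun i j : Fin 3 => if i.val + j.val + 1 = 3 then (1 : L) else 0))),
      -- (Q-∞)
      (∃ (νi : Measure (arch (↥(maximalRealSubfield L)) L (IsCMField.complexConj L) 3 H')) (_ : νi.IsHaarMeasure) (_ : νi.IsMulRightInvariant)
          (tGi : ∀ γ : arch (↥(maximalRealSubfield L)) L (IsCMField.complexConj L) 3 H', Measure ↥(Subgroup.centralizer ({γ} : Set (arch (↥(maximalRealSubfield L)) L (IsCMField.complexConj L) 3 H')))),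
        mGis.IsQuotientOf (fun x : arch (↥(maximalRealSubfield L)) L (IsCMField.complexConj L) 3 H' => ∃ γ₀ : (cmDatum L 3 H').Rational, ¬ IsRegularElt (γ₀.val : GL (Fin 3) L) ∧
          Corresponds (conjMixed (↥(maximalRealSubfield L)) L (IsCMField.complexConj L)) (archFormOf L 3 H') (archFormOf L 3 H') (cmRationalToArch L 3 H' γ₀) x) νi tGi) ∧
      -- (Q-q∞)
      (∃ (νq : Measure (arch (↥(maximalRealSubfield L)) L (IsCMField.complexConj L) 3 (Matrix.of fun i j : Fin 3 => if i.val + j.val + 1 = 3 then (1 : L) else 0))) (_ : νq.IsHaarMeasure) (_ : νq.IsMulRightInvariant)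
          (tqi : ∀ γ : arch (↥(maximalRealSubfield L)) L (IsCMField.complexConj L) 3 (Matrix.of fun i j : Fin 3 => if i.val + j.val + 1 = 3 then (1 : L) else 0), Measure ↥(Subgroup.centralizer ({γ} : Set (arch (↥(maximalRealSubfield L)) L (IsCMField.complexConj L) 3 (Matrix.of fun i j : Fin 3 => if i.val + j.val + 1 = 3 then (1 : L) else 0))))),
        mqis.IsQuotientOf (fun x : arch (↥(maximalRealSubfield L)) L (IsCMField.complexConj L) 3 (Matrix.of fun i j : Fin 3 => if i.val + j.val + 1 = 3 then (1 : L) else 0) => ∃ γ₀ : (cmDatum L 3 H').Rational, ¬ IsRegularElt (γ₀.val : GL (Fin 3) L) ∧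
          Corresponds (conjMixed (↥(maximalRealSubfield L)) L (IsCMField.complexConj L)) (archFormOf L 3 H') (archFormOf L 3 (Matrix.of fun i j : Fin 3 => if i.val + j.val + 1 = 3 then (1 : L) else 0)) (cmRationalToArch L 3 H' γ₀) x) νq tqi) ∧
      -- (C1), archimedean half
      (∀ c : ConjClasses (cmDatum L 3 H').Rational,
        (∃ ζ : L, (((Quotient.out c).val : GL (Fin 3) L) : Matrix (Fin 3) (Fin 3) L) = ζ • (1 : Matrix (Fin 3) (Fin 3) L)) →
        mGis.atPoint (archPart (↥(maximalRealSubfield L)) L (IsCMField.complexConj L) 3 H' ((cmDatum L 3 H').toAdelic (Quotient.out c))) Set.univ = 1) ∧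
      -- (C1-q)
      (∀ c : ConjClasses (cmDatum L 3 (Matrix.of fun i j : Fin 3 => if i.val + j.val + 1 = 3 then (1 : L) else 0)).Rational,
        (∃ ζ : L, (((Quotient.out c).val : GL (Fin 3) L) : Matrix (Fin 3) (Fin 3) L) = ζ • (1 : Matrix (Fin 3) (Fin 3) L)) →
        mqis.atPoint (archPart (↥(maximalRealSubfield L)) L (IsCMField.complexConj L) 3 (Matrix.of fun i j : Fin 3 => if i.val + j.val + 1 = 3 then (1 : L) else 0) ((cmDatum L 3 (Matrix.of fun i j : Fin 3 => if i.val + j.val + 1 = 3 then (1 : L) else 0)).toAdelic (Quotient.out c))) Set.univ = 1) ∧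
      -- (ST-∞-s)
      (∀ (a' : arch (↥(maximalRealSubfield L)) L (IsCMField.complexConj L) 3 H' → ℂ) (a : arch (↥(maximalRealSubfield L)) L (IsCMField.complexConj L) 3 (Matrix.of fun i j : Fin 3 => if i.val + j.val + 1 = 3 then (1 : L) else 0) → ℂ),
        ArchSmooth L 3 H' a' → ArchSmooth L 3 (Matrix.of fun i j : Fin 3 => if i.val + j.val + 1 = 3 then (1 : L) else 0) a → IsArchInnerTransfer L H' m' m a' a →
        ∀ (γ₀ : (cmDatum L 3 H').Rational) (γ : (cmDatum L 3 (Matrix.of fun i j : Fin 3 => if i.val + j.val + 1 = 3 then (1 : L) else 0)).Rational) (e₁ e₂ : L),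
          Corresponds (cmConjRingHom L) H' (Matrix.of fun i j : Fin 3 => if i.val + j.val + 1 = 3 then (1 : L) else 0) (γ₀ : unitaryGroup (cmConjRingHom L) H') (γ : unitaryGroup (cmConjRingHom L) (Matrix.of fun i j : Fin 3 => if i.val + j.val + 1 = 3 then (1 : L) else 0)) →
          e₁ ≠ e₂ →
          ((((γ₀ : unitaryGroup (cmConjRingHom L) H').val : GL (Fin 3) L) : Matrix (Fin 3) (Fin 3) L) - e₁ • (1 : Matrix (Fin 3) (Fin 3) L)) *
            ((((γ₀ : unitaryGroup (cmConjRingHom L) H').val : GL (Fin 3) L) : Matrix (Fin 3) (Fin 3) L) - e₂ • (1 : Matrix (Fin 3) (Fin 3) L)) = 0 →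
          (¬ ∃ ζ : L, (((γ₀ : unitaryGroup (cmConjRingHom L) H').val : GL (Fin 3) L) : Matrix (Fin 3) (Fin 3) L) = ζ • (1 : Matrix (Fin 3) (Fin 3) L)) →
          archStableOrbitalIntegral L 3 H' mGis (fun x => kottwitzSignArchWeight L 3 H' (ConjClasses.mk x) * a' x) (cmRationalToArch L 3 H' γ₀) =
            archStableOrbitalIntegral L 3 (Matrix.of fun i j : Fin 3 => if i.val + j.val + 1 = 3 then (1 : L) else 0) mqis
              (fun x => kottwitzSignArchWeight L 3 (Matrix.of fun i j : Fin 3 => if i.val + j.val + 1 = 3 then (1 : L) else 0) (ConjClasses.mk x) * a x) (cmRationalToArch L 3 (Matrix.of fun i j : Fin 3 => if i.val + j.val + 1 = 3 then (1 : L) else 0) γ)) := by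
  obtain ⟨α', P, hP, hα', hhermα⟩ := exists_rational_diagonal_frame L H' hherm hd'
  exact exists_archSingularMembers L H' hherm hanis α' P hP hα' hhermα ![(2 : L)⁻¹, 1, -(2 : L)⁻¹]
    (Matrix.GeneralLinearGroup.mkOfDetNeZero !![(1 : L), 0, 1; 0, 1, 0; 1, 0, -1] (det_quasiSplitFrame_ne_zero L)) (formCongr_quasiSplitFrame_diagonal L)
    (quasiSplitWeights_ne_zero L) (fun i => cmConjRingHom_quasiSplitWeights L i) ν' ν t' t hd' hd₃ hC hC'G m' m hW' hW

end Literature.NumberTheory.Rogawski1990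

end
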